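import Summits.Parity.GeneralizedHardyLittlewood.Theorems.LiouvilleShiftedTablesTypeI2DilatedMainTerms1
import Summits.Parity.GeneralizedHardyLittlewood.Theorems.LiouvilleShiftedTablesTypeI2DilatedMainTerms7
import Summits.Parity.GeneralizedHardyLittlewood.Theorems.LiouvilleShiftedTablesTypeI2DilatedMainTerms8

/-!
# Main terms of the line `peel-to-drappeau` (crux `TypeI2Dilated`, stmt-Parity-14272) — the stub `stub_mainTerms`

`stub_mainTerms : MainTermsStep := BVLiouville → DilatedMainTerms` (vocabulary in
`Theorems/LiouvilleShiftedTablesDefs.lean`), assembled from the chain `…MainTerms1–8.lean`: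

* parameters: `ρ₀ = 1/1000`; given `0 < ρ ≤ ρ₀` and `A > 0`: `B = A + 134`, `F₀ = ⌊(log x)^B⌋`,
  `D₀ = ⌊x^{3/1000}⌋`, family Bombieri–Vinogradov (`family_bv`, from the hypothesis `BVLiouville`) with
  `ε = 1/4`, exponent `4A + 404 = 3B + A + 2`, multiplicity `τ(m)³`, at the scale `2x`;
* the blocks are indexed by `T = [1, Pm] × ([1, x^ρ] × [1, R])`; `total_raw_le` (file VII) bounds their sum by
  the raw total, and `final_arith` (file VIII) turns the raw total into `C x/(log x)^A`,
  `C = 722 C_f + 12840960000 C₅ + 3`, once `x ≥ x₀` (`x₀` collects the family threshold, `16`, `2^{334}`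
  (so that `x^{3/1000} ≥ 2`) and four `log`-vs-power thresholds from `Negative.exists_log_rpow_le`).
[this line: Lines/peel-to-drappeau.md]
-/

noncomputable section

namespace Summit.Parity.GeneralizedHardyLittlewood.Cruxes.TypeI2Dilated.PeelToDrappeau

open Finset Real Complex
open scoped ArithmeticFunction.sigma Classical
open Literature.NumberTheory.Sieve Literature.NumberTheory.Sieve.Drappeau2017 LiouvilleMV
open ArithmeticFunction (liouville)

/-- `⌊t⌋ ≥ t/2` for `t ≥ 2`. [folklore] -/
theorem half_le_floor {t : ℝ} (ht : 2 ≤ t) : t / 2 ≤ (⌊t⌋₊ : ℝ) := by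
  have h := Nat.sub_one_lt_floor t
  linarith

/-- `exp 2 ≤ 16`. [folklore] -/
theorem exp_two_le_sixteen : Real.exp 2 ≤ 16 := by
  have h := Real.exp_one_lt_d9
  have h0 := Real.exp_pos 1
  have : Real.exp 2 = Real.exp 1 ^ 2 := by rw [← Real.exp_nat_mul]; norm_num
  rw [this]; nlinarith

/-- **The stub `stub_mainTerms` of the line `peel-to-drappeau`**: `BVLiouville → DilatedMainTerms`.
[this line] -/
theorem stub_mainTerms : MainTermsStep := by
  intro hBV c _hc
  refine ⟨1 / 1000, by norm_num, ?_⟩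
  intro ρ hρ hρ₀ A hA
  -- constants
  obtain ⟨Cf, xf, hCf, hfam⟩ :=
    family_bv hBV (ε := 1 / 4) (by norm_num) le_rfl (A := 4 * A + 404) (by linarith) 3
  obtain ⟨C₃, hC₃, hS₃⟩ := exists_sum_sigma_zero_pow_div_le_real 3
  obtain ⟨C₅, hC₅, hS₅⟩ := exists_sum_sigma_zero_pow_div_totient_le_real 5
  obtain ⟨X₁, hX₁⟩ := Negative.exists_log_rpow_le (A + 18) (s := 1 / 1000) (K := 1 / (1444 * C₃))
    (by norm_num) (by positivity)
  obtain ⟨X₂', hX₂'⟩ := Negative.exists_log_rpow_le (A + 2) (s := 1 / 2) (K := 1 / 361)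
    (by norm_num) (by norm_num)
  obtain ⟨X₃, hX₃⟩ := Negative.exists_log_rpow_le (A + 6) (s := 1 / 10) (K := 1 / 33000000000)
    (by norm_num) (by norm_num)
  obtain ⟨X₄, hX₄⟩ := Negative.exists_log_rpow_le (A + 134) (s := 1 / 5) (K := 1) (by norm_num) one_pos
  refine ⟨722 * Cf + 12840960000 * C₅ + 3,
    max (max (max xf 16) (max X₁ X₂')) (max (max X₃ X₄) ((2 : ℝ) ^ (334 : ℕ))), ?_⟩
  intro x hx u v Y R Slo S Rd Pm hY hPR hSR hRd1 hRdx
  -- thresholds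
  simp only [max_le_iff] at hx
  obtain ⟨⟨⟨hxf, hx16⟩, hxX₁, hxX₂'⟩, ⟨hxX₃, hxX₄⟩, hx334⟩ := hx
  -- `x^{3/1000} ≥ 2` (the only use of `x ≥ 2^334`; the huge literal is cleared at once, it upsets `linarith`)
  have hx3 : (2 : ℝ) ≤ x ^ (3 / 1000 : ℝ) := by
    have h1 : ((2 : ℝ) ^ (334 : ℕ)) ^ (3 / 1000 : ℝ) ≤ x ^ (3 / 1000 : ℝ) :=
      Real.rpow_le_rpow (by positivity) hx334 (by norm_num)
    refine le_trans ?_ h1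
    rw [← Real.rpow_natCast, ← Real.rpow_mul (by norm_num)]
    calc (2 : ℝ) = 2 ^ (1 : ℝ) := (Real.rpow_one _).symm
      _ ≤ 2 ^ ((334 : ℕ) * (3 / 1000 : ℝ)) := Real.rpow_le_rpow_of_exponent_le (by norm_num) (by norm_num)
  clear hx334
  have hx0 : 0 < x := by linarith
  have hx1 : 1 ≤ x := by linarith
  set ℓx := Real.log x with hℓx
  have hℓx2 : 2 ≤ ℓx := by
    rw [hℓx, Real.le_log_iff_exp_le hx0]; exact exp_two_le_sixteen.trans hx16
  have hℓx1 : 1 ≤ ℓx := by linarith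
  have hℓx0 : 0 < ℓx := by linarith
  have hCpos : 0 < 722 * Cf + 12840960000 * C₅ + 3 := by positivity
  have hRHS : 0 ≤ (722 * Cf + 12840960000 * C₅ + 3) * x / Real.log x ^ A := by
    rw [← hℓx]; positivity
  -- parameters
  set N : ℕ := ⌊Y⌋₊ with hN
  set K : ℕ := ⌊Rd⌋₊ with hK
  set Q : ℕ := ⌊x ^ ρ⌋₊ with hQ
  set Rn : ℕ := ⌊R⌋₊ with hRn
  set T : Finset (ℕ × ℕ × ℕ) := Icc 1 Pm ×ˢ (Icc 1 Q ×ˢ Icc 1 Rn) with hT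
  set X₂ : ℕ := Q * (Rn * Pm) with hX₂
  set F₀ : ℕ := ⌊ℓx ^ (A + 134)⌋₊ with hF₀
  set D₀ : ℕ := ⌊x ^ (3 / 1000 : ℝ)⌋₊ with hD₀
  set W : ℝ := 7 + 12 * ℓx with hW
  -- the blocks, as a function of `(P, q, r)`
  set BLK : ℕ → ℕ → ℕ → ℝ := fun P q r =>
    ‖∑ s ∈ sRange c q (r * P) (Slo / P) (S / P),
        ∑ m ∈ (Icc 1 N).filter (fun m : ℕ =>
            (m : ZMod (r * P)) = ((u (r * P) : ℤ) : ZMod (r * P)) ∧ (m : ZMod q) = ((v q : ℤ) : ZMod q)),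
          (ArithmeticFunction.liouville m : ℂ) * mainKernel Rd s ((m : ZMod s) * ((c : ZMod s))⁻¹)‖
    with hBLK
  show ∑ P ∈ Icc 1 Pm, ∑ q ∈ Icc 1 Q, ∑ r ∈ Icc 1 Rn, BLK P q r ≤ _
  have hLHS : ∑ τ ∈ T, BLK τ.1 τ.2.1 τ.2.2 = ∑ P ∈ Icc 1 Pm, ∑ q ∈ Icc 1 Q, ∑ r ∈ Icc 1 Rn, BLK P q r := by
    rw [hT, sum_product]
    refine sum_congr rfl fun P _ => ?_
    rw [sum_product]
  rw [← hLHS]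
  -- the empty family
  rcases T.eq_empty_or_nonempty with hTe | ⟨τ₀, hτ₀⟩
  · rw [hTe, sum_empty]; exact hRHS
  -- from now on `Pm, Q, Rn ≥ 1`, hence `R ≥ 1`
  have hτ₀' := hτ₀
  rw [hT, mem_product, mem_product, mem_Icc, mem_Icc, mem_Icc] at hτ₀'
  have hPm1 : 1 ≤ Pm := hτ₀'.1.1.trans hτ₀'.1.2
  have hQ1 : 1 ≤ Q := hτ₀'.2.1.1.trans hτ₀'.2.1.2
  have hRn1 : 1 ≤ Rn := hτ₀'.2.2.1.trans hτ₀'.2.2.2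
  have hR1 : 1 ≤ R := (Nat.floor_pos.1 hRn1)
  have hR0 : 0 ≤ R := by linarith
  have hRd0 : 0 ≤ Rd := by linarith
  have hxρ0 : 0 ≤ x ^ ρ := Real.rpow_nonneg hx0.le _
  -- positivity of the coordinates and the moduli
  have hTpos : ∀ τ ∈ T, 0 < τ.1 ∧ 0 < τ.2.1 ∧ 0 < τ.2.2 := by
    intro τ hτ
    rw [hT, mem_product, mem_product, mem_Icc, mem_Icc, mem_Icc] at hτ
    exact ⟨hτ.1.1, hτ.2.1.1, hτ.2.2.1⟩
  have hX₂b : ∀ τ ∈ T, Nat.lcm τ.2.1 (τ.2.2 * τ.1) ≤ X₂ := by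
    intro τ hτ
    obtain ⟨hP, hq, hr⟩ := hTpos τ hτ
    rw [hT, mem_product, mem_product, mem_Icc, mem_Icc, mem_Icc] at hτ
    refine (Nat.le_of_dvd (Nat.mul_pos hq (Nat.mul_pos hr hP)) (Nat.lcm_dvd_mul _ _)).trans ?_
    exact Nat.mul_le_mul hτ.2.1.2 (Nat.mul_le_mul hτ.2.2.2 hτ.1.2)
  -- sizes of the parameters
  have hQle : (Q : ℝ) ≤ x ^ ρ := Nat.floor_le hxρ0
  have hRnPm : ((Rn * Pm : ℕ) : ℝ) ≤ x ^ ρ := by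
    push_cast
    calc (Rn : ℝ) * Pm ≤ R * Pm := by gcongr; exact Nat.floor_le hR0
      _ = Pm * R := by ring
      _ ≤ x ^ ρ := hPR
  have h2ρ : x ^ ρ * x ^ ρ ≤ x ^ (2 / 1000 : ℝ) := by
    rw [← Real.rpow_add hx0]
    exact Real.rpow_le_rpow_of_exponent_le hx1 (by linarith)
  have hX₂le : (X₂ : ℝ) ≤ x ^ (2 / 1000 : ℝ) := by
    rw [hX₂, Nat.cast_mul]
    exact (mul_le_mul hQle hRnPm (Nat.cast_nonneg _) hxρ0).trans h2ρ
  have hX₂x : (X₂ : ℝ) ≤ x :=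
    hX₂le.trans ((Real.rpow_le_rpow_of_exponent_le hx1 (by norm_num)).trans_eq (Real.rpow_one x))
  have hX₂fl : X₂ ≤ ⌊x⌋₊ := Nat.le_floor hX₂x
  have hX₂1 : 1 ≤ X₂ := Nat.mul_pos hQ1 (Nat.mul_pos hRn1 hPm1)
  have hKle : (K : ℝ) ≤ x ^ (1 / 1000 : ℝ) := (Nat.floor_le hRd0).trans hRdx
  have hK1 : 1 ≤ K := Nat.le_floor (by simpa using hRd1)
  have hNle : (N : ℝ) ≤ 2 * x := by
    rcases le_or_gt 0 Y with hY0 | hY0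
    · exact (Nat.floor_le hY0).trans hY
    · rw [hN, Nat.floor_of_nonpos hY0.le, Nat.cast_zero]; linarith
  -- `F₀` and `D₀`
  have hℓB1 : (2 : ℝ) ≤ ℓx ^ (A + 134) := by
    calc (2 : ℝ) ≤ ℓx := hℓx2
      _ = ℓx ^ (1 : ℝ) := (Real.rpow_one _).symm
      _ ≤ ℓx ^ (A + 134) := Real.rpow_le_rpow_of_exponent_le hℓx1 (by linarith)
  have hF₀u : (F₀ : ℝ) ≤ ℓx ^ (A + 134) := Nat.floor_le (by linarith)
  have hF₀l : ℓx ^ (A + 134) / 2 ≤ F₀ := half_le_floor hℓB1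
  have hF₀1 : (1 : ℝ) ≤ F₀ := by linarith
  have hF₀pos : 0 < F₀ := by exact_mod_cast hF₀1
  have hD₀u : (D₀ : ℝ) ≤ x ^ (3 / 1000 : ℝ) := Nat.floor_le (by linarith)
  have hD₀l : x ^ (3 / 1000 : ℝ) / 2 ≤ D₀ := half_le_floor hx3
  have hD₀1 : (1 : ℝ) ≤ D₀ := by linarith
  have hD₀pos : 0 < D₀ := by exact_mod_cast hD₀1
  -- the weights
  have hW0 : 0 ≤ W := by rw [hW]; positivity
  have hWτ : ∀ τ ∈ T, weightW (S / τ.1) ≤ W := by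
    intro τ hτ
    obtain ⟨hP, -, -⟩ := hTpos τ hτ
    refine weightW_le_of_le hx1 ?_
    rcases le_or_gt S 0 with hS0 | hS0
    · rw [Nat.floor_of_nonpos (div_nonpos_of_nonpos_of_nonneg hS0 (Nat.cast_nonneg _)), Nat.cast_zero]
      exact hx0.le
    · have hSx : S ≤ x := by
        calc S = S * 1 := (mul_one S).symm
          _ ≤ S * R := mul_le_mul_of_nonneg_left hR1 hS0.le
          _ ≤ x ^ (1 / 2 + ρ) := hSR
          _ ≤ x ^ (1 : ℝ) := Real.rpow_le_rpow_of_exponent_le hx1 (by linarith)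
          _ = x := Real.rpow_one x
      have hSP : S / τ.1 ≤ S := div_le_self hS0.le (by exact_mod_cast hP)
      exact (Nat.floor_le (div_nonneg hS0.le (Nat.cast_nonneg _))).trans (hSP.trans hSx)
  -- the family bound at the scale `2x`
  set Bf : ℝ := Cf * (2 * x) / Real.log (2 * x) ^ (4 * A + 404) with hBf
  have hlog2x : ℓx ≤ Real.log (2 * x) := Real.log_le_log hx0 (by linarith)
  have hlog2x0 : 0 < Real.log (2 * x) := hℓx0.trans_le hlog2x
  have hBf0 : 0 ≤ Bf := by rw [hBf]; positivity
  have hBfle : Bf ≤ 2 * Cf * x / ℓx ^ (4 * A + 404) := by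
    rw [hBf, show Cf * (2 * x) = 2 * Cf * x by ring]
    refine div_le_div_of_nonneg_left (by positivity) (Real.rpow_pos_of_pos hℓx0 _) ?_
    exact Real.rpow_le_rpow hℓx0.le hlog2x (by linarith)
  have hxpow : x ^ (2 / 1000 : ℝ) * x ^ (1 / 5 : ℝ) ≤ (2 * x) ^ (1 / 4 : ℝ) := by
    rw [← Real.rpow_add hx0]
    calc x ^ (2 / 1000 + 1 / 5 : ℝ) ≤ x ^ (1 / 4 : ℝ) := Real.rpow_le_rpow_of_exponent_le hx1 (by norm_num)
      _ ≤ (2 * x) ^ (1 / 4 : ℝ) := Real.rpow_le_rpow hx0.le (by linarith) (by norm_num)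
  have hMX : ∀ τ ∈ T, ((Nat.lcm τ.2.1 (τ.2.2 * τ.1) * F₀ : ℕ) : ℝ) ≤ (2 * x) ^ (1 / 4 : ℝ) := by
    intro τ hτ
    rw [Nat.cast_mul]
    refine le_trans ?_ hxpow
    refine mul_le_mul ((Nat.cast_le.2 (hX₂b τ hτ)).trans hX₂le) (hF₀u.trans ?_) (Nat.cast_nonneg _)
      (Real.rpow_nonneg hx0.le _)
    simpa only [one_mul, hℓx] using hX₄ x hxX₄
  have hfam' : ∀ (M z H : ℕ × ℕ × ℕ → ℕ),
      (∀ τ ∈ T, 1 ≤ M τ ∧ (M τ : ℝ) ≤ (2 * x) ^ (1 / 4 : ℝ) ∧ (H τ : ℝ) ≤ 2 * x) →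
      (∀ m : ℕ, ((T.filter (fun τ => M τ = m)).card : ℝ) ≤ (σ 0 m : ℝ) ^ 3) →
        ∑ τ ∈ T, |∑ t ∈ (Icc 1 (H τ)).filter (fun t : ℕ => (t : ZMod (M τ)) = ((z τ : ℕ) : ZMod (M τ))),
          (liouville t : ℝ)| ≤ Bf := by
    intro M z H hM hmult
    have h := hfam (2 * x) (by linarith) T M z H (fun i hi => ⟨(hM i hi).1,
      by rw [show (1 : ℝ) / 2 - 1 / 4 = 1 / 4 by norm_num]; exact (hM i hi).2.1, (hM i hi).2.2⟩) hmult
    exact h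
  -- the raw total
  have hraw := total_raw_le c u v Slo S Y Rd hRd1 T hTpos hX₂b hF₀pos hD₀pos hW0 hWτ hBf0 hNle hMX hfam'
  rw [← hN, ← hK] at hraw
  -- the divisor sums
  set S₃ : ℝ := ∑ L ∈ Icc 1 X₂, (σ 0 L : ℝ) ^ 3 * (1 / (L : ℝ)) with hS₃def
  set S₅a : ℝ := ∑ L ∈ Icc 1 X₂, (σ 0 L : ℝ) ^ 5 with hS₅adef
  set S₅b : ℝ := ∑ L ∈ Icc 1 X₂, (σ 0 L : ℝ) ^ 5 / (Nat.totient L : ℝ) with hS₅bdef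
  have hsub : Icc 1 X₂ ⊆ Icc 1 ⌊x⌋₊ := Icc_subset_Icc_right hX₂fl
  have hx2 : (2 : ℝ) ≤ x := by linarith
  have hS₃le : S₃ ≤ C₃ * ℓx ^ (16 : ℕ) := by
    have h := hS₃ x hx2
    rw [show (2 : ℕ) ^ (3 + 1) = 16 by norm_num] at h
    calc S₃ = ∑ L ∈ Icc 1 X₂, (σ 0 L : ℝ) ^ 3 / L := sum_congr rfl fun L _ => by rw [mul_one_div]
      _ ≤ ∑ L ∈ Icc 1 ⌊x⌋₊, (σ 0 L : ℝ) ^ 3 / L :=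
          sum_le_sum_of_subset_of_nonneg hsub fun L _ _ => by positivity
      _ ≤ _ := h
  have hS₅ble : S₅b ≤ C₅ * ℓx ^ (128 : ℕ) := by
    have h := hS₅ x hx2
    rw [show (2 : ℕ) ^ (5 + 2) = 128 by norm_num] at h
    exact (sum_le_sum_of_subset_of_nonneg hsub fun L _ _ => by positivity).trans h
  have hS₅ale : S₅a ≤ (X₂ : ℝ) ^ (6 : ℕ) := by
    have hterm : ∀ L ∈ Icc 1 X₂, (σ 0 L : ℝ) ^ 5 ≤ (X₂ : ℝ) ^ 5 := by
      intro L hL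
      have hL := mem_Icc.1 hL
      have hσ : (σ 0 L : ℝ) ≤ X₂ := by
        rw [ArithmeticFunction.sigma_zero_apply]
        exact_mod_cast (Nat.card_divisors_le_self L).trans hL.2
      exact pow_le_pow_left₀ (Nat.cast_nonneg _) hσ 5
    refine (sum_le_sum hterm).trans ?_
    rw [sum_const, Nat.card_Icc, add_tsub_cancel_right, nsmul_eq_mul]
    exact le_of_eq (by ring)
  have hsplit5 : ∑ L ∈ Icc 1 X₂, (σ 0 L : ℝ) ^ 3 * ((σ 0 L : ℝ) ^ 2 *
      (D₀ * (2 + (((2 + N : ℝ) ^ (5 / 6 : ℝ) * (K * X₂ : ℕ) +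
        (2 + N : ℝ) ^ (1 / 2 : ℝ) * ((K * X₂ : ℕ) : ℝ) ^ 2) * (1 + Real.log (2 + N : ℝ)))) +
        N / Nat.totient L * (1 + Real.log D₀))) =
      D₀ * (2 + (((2 + N : ℝ) ^ (5 / 6 : ℝ) * (K * X₂ : ℕ) +
        (2 + N : ℝ) ^ (1 / 2 : ℝ) * ((K * X₂ : ℕ) : ℝ) ^ 2) * (1 + Real.log (2 + N : ℝ)))) * S₅a +
        N * (1 + Real.log D₀) * S₅b := by
    rw [hS₅adef, hS₅bdef, mul_sum, mul_sum, ← sum_add_distrib]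
    refine sum_congr rfl fun L _ => ?_
    ring
  -- card of the family
  have hcard : (T.card : ℝ) ≤ x ^ (2 / 1000 : ℝ) := by
    rw [hT, card_product, card_product, Nat.card_Icc, Nat.card_Icc, Nat.card_Icc]
    simp only [add_tsub_cancel_right]
    calc ((Pm * (Q * Rn) : ℕ) : ℝ) = (X₂ : ℝ) := by rw [hX₂]; push_cast; ring
      _ ≤ x ^ (2 / 1000 : ℝ) := hX₂le
  -- `K X₂`
  have hKX1 : (1 : ℝ) ≤ ((K * X₂ : ℕ) : ℝ) := by exact_mod_cast Nat.mul_pos hK1 hX₂1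
  have hKX : ((K * X₂ : ℕ) : ℝ) ≤ x ^ (3 / 1000 : ℝ) := by
    rw [Nat.cast_mul, show (3 / 1000 : ℝ) = 1 / 1000 + 2 / 1000 by norm_num, Real.rpow_add hx0]
    exact mul_le_mul hKle hX₂le (Nat.cast_nonneg _) (Real.rpow_nonneg hx0.le _)
  have hWle : W ≤ 19 * ℓx := by rw [hW]; linarith
  -- conclusion
  have hfin := final_arith (K := (K : ℝ)) (N := (N : ℝ)) (D₀ := (D₀ : ℝ)) (F₀ := (F₀ : ℝ))
    (X₂ := (X₂ : ℝ)) (KX := ((K * X₂ : ℕ) : ℝ)) (W := W) (cT := (T.card : ℝ)) (S₃ := S₃) (S₅a := S₅a)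
    (S₅b := S₅b) (Bf := Bf) hA hCf hC₃ hC₅ hx16 hℓx2 hℓx.symm (Nat.cast_nonneg _) hKle
    (Nat.cast_nonneg _) hNle hD₀l hD₀u hD₀1 hF₀l hF₀u hF₀1 (Nat.cast_nonneg _) hX₂le hKX1 hKX hW0 hWle
    (Nat.cast_nonneg _) hcard (sum_nonneg fun L _ => by positivity) hS₃le
    (sum_nonneg fun L _ => by positivity) hS₅ale (sum_nonneg fun L _ => by positivity) hS₅ble hBf0 hBfle
    (by simpa only [hℓx] using hX₁ x hxX₁) (by simpa only [hℓx] using hX₂' x hxX₂')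
    (by simpa only [hℓx] using hX₃ x hxX₃)
  rw [hsplit5] at hraw
  exact hraw.trans hfin

end Summit.Parity.GeneralizedHardyLittlewood.Cruxes.TypeI2Dilated.PeelToDrappeau

end
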